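import Summits.AtomisticToContinuum.HydrodynamicLimit.Theses.CollisionIsometryCLT

/-!
# Line `moment-transport-isotropy-parity` for the crux `AdaptedWeightCLT` (stmt-AtomisticToContinuum-12949)

Route `CollisionIsometryCLT`, crux rank 2: `∀ profiles ∃ σ₀ ∀ σ < σ₀ ∀ Φ, H1(σ,Φ) → H2(σ,Φ) → C(σ,Φ)`,
H1 = conclusion of `DiffuseBackwardInfluence` (mean inverse participation ratio of the frozen-geometry
velocity transfer `M` over every admissible kinetic window `→ 0`), H2 = `AprioriBounds` (i)
(time-averaged one-particle exponential velocity moment), C = conclusion of the target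
`FastMomentRelaxation` (block traceless kinetic stress `D` and block kinetic heat flux `q` vanish in
`L²([0,t] × 𝕋³)` in probability, all `t > 0`, `γ ≤ 1/15`).

## The lever (crux idea `moment-transport-isotropy-parity`, triage r1: fail / pass / pass, sharpened)

The Euler closure of the KINETIC fluxes is isotropy ⊕ parity of the block velocity law, i.e. two
polynomials of the peculiar velocities — NOT Gaussianity. Transport them EXACTLY through ONE kinetic
window `[s − Δ, s]` along the crux's own transfer: the rows of `M` sum to `𝟙` (Galilean invariance: the
fold fixes constant velocity fields) and `M` is linear, so for EVERY shift `u`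
  `v_i(s) − u = Σ_k M_ik a_k`,  `a_k := v_k(s−Δ) − u`  (`M_ik` = the `3 × 3` blocks, `blockM`),
and the rank-`r` block moment tested against `C` (rank 2: `C2 j k`, traceless; rank 3: `C3 a`) is the
multilinear expansion `Σ_{k₁…k_r} ⟨C, ⊗_s M_{ik_s} a_{k_s}⟩`, read as THREE functionals of the COHERENT
transfer (no incoherent/decoupled transport anywhere — the objects are functionals of the very `M` that
H1 speaks about):
* `DIAG` (all `k_s` equal) `= Σ_k M_ik^{⊗r} a_k^{⊗r}`, split further as `MF + SEL`:
  `MF` = the ROW TRANSPORT `𝒯_i : S ↦ Σ_k M_ik^{⊗r} S` of ONE reference past tensor `S̄^{(r)}` (the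
  influence-weighted block average of the `a_k^{⊗r}`, weights `Σ_i w_i ‖M_ik‖_F²/3`), and
  `SEL := DIAG − MF` = the SELECTION covariance between the row weights `M_ik ⊗ M_ik` and the ancestor
  tensors (triage r1-3: the `k = l` term the original card missed; `O(1)` at `ipr → 0` for adapted `M`);
* `INT` (not all `k_s` equal) = the INTERFERENCE pair/triple form (`intT`), whose matrix kernel
  `G_{kl} = Σ_i w_i M_ikᵀ C M_il /(N+1)` has vanishing Hilbert–Schmidt mass `≲ N^{3γ−1}` and whose
  unweighted trace is identically `0` (column orthonormality `Σ_i M_ikᵀ M_il = δ_kl 𝟙`: energy is carried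
  by `DIAG` alone, interference only redistributes it).
Exact consequences of `M` being ORTHOGONAL with Galilean rows (`stub_rowSplit`, `TransferOrthonormal`):
row orthonormality `Σ_k M_ik M_ikᵀ = 𝟙` makes the isotropic part of the past INVISIBLE to the traceless
tests after transport (`𝒯_i(𝟙) = 𝟙` exactly), so `MF` sees only `tl S̄` and is killed by ROW ROTATIONAL
CONTRACTION of the coherent transfer (`stub_rowContraction`: the rank-2 traceless sector of `𝒯_i`
depolarises along the line window in local-Gibbs mean ⇐ H1 + one-step normal non-degeneracy; the
rank-3 row transport is slaved to `ipr` outright, `Σ_k ‖M_ik‖_F³ ≤ √3 · ipr_i^{1/2}` — H1 IS the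
heat-flux lemma) plus tails (`stub_meanFieldDamping` ⇐ RC ∧ H1 ∧ H2; the initial layer `s < Δℓ_N` is
inside it, because with the zero window `M = 𝟙` and `MF = Blk`).
The whole adapted / chaos content is ONE signed, LAGGED response statement (`stub_laggedResponse`, the
load-bearing stub; triage r1-2's "Volterra form", r1-1's circularity objection answered by the LAG):
the non-mean-field part `SEL + INT`, correlated with the PRESENT block moments, is at most a fraction
`c < 1` of the flux defect at the window START, in `L¹([0,t] × 𝕋³)`-probability. Prediction (chaotic
regime, triage r1-1's kinetic bookkeeping): over a window of `m` own-collisions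
`Blk(s) ≈ e^{−(4/5)νm} Blk(s−Δ)` (hard-sphere deviator
rate, first Sonine) while the velocity-BLIND row transport gives `MF ≈ e^{−(2/5)νm} Blk(s−Δ)`, the
difference being carried by adapted selection `≈ (1/5)ν` and cross interference `≈ (1/5)ν`, both
RELAXING — so `SEL + INT ≈ (e^{−0.8m} − e^{−0.4m}) Blk(s−Δ)` is a RESTORING response (`INT` anti-aligned
with `D`: `cos(INT, D) < 0`, pre-registered in toys j010481 / j010619 / j010642 / j010567),
`RESP ≈ e^{−1.2m}(e^{−0.4m} − 1) F(s−Δ) ≤ 0` at every finite collision depth, and the window gain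
`F(s)/F(s−Δ) ≈ e^{−1.6m} → 0` on admissible windows (`m ≍ n_N → ∞`): the stub asks only for SOME
`c < 1`, leaving the whole interval as margin for renormalised (adapted, ring-dressed) statistics.
`stub_reduction` (measure theory + three lines of real analysis) closes:
`Σ_b Blk_b² = Σ_b Blk_b (MF_b + SEL_b + INT_b) ≤ η Σ Blk² + (4η)⁻¹ Σ MF² + RESP`, integrate,
`∫₀ᵗ lagDefect ≤ ∫₀ᵗ (|D|²+|q|²)`, so `(1 − η − c⁺) ∫∫(|D|²+|q|²) ≤ (4η)⁻¹·o(1) + δ`.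
Line window: `Δℓ_N = (N+1)^{-1/3} log(N+2)` (shared vocabulary; admissible, `N^{4γ}Δℓ_N → 0`), zero
window in the initial layer (no negative times).

## Shared vocabulary
The crux's fold `pre/stepMap/transferSteps/steps/velAfter/iprF` (verbatim the crux's `let M; let ipr`,
so H1 is `DiffuseAt` by ζδ-reduction), the tensors `tpow/mapT/pairT/normSqT`, the probes `dirV`, the
tests `C2/C3`, the window `Δℓ/winLen/winStart` and the flow-side `wgt/ubar/blkFlow/DefectSq` below
are BYTE-FOR-BYTE copies (same names) of the sibling line's vocabulary
(`Lines/contact-source-duhamel.lean`, landed as `Theorems/CollisionIsometryCLTAdaptedWeightCLTLine.lean`,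
namespace `…Theorems.ContactSourceDuhamel`, p81714; copied rather than imported only so that this file
elaborates independently of the farm's build state of that module). Hence `FlowDictionary` below is the
sibling line's stub 2 up to unfolding (one proof — the drefute seat's
`DrefuteFoldDictionary.flowDictionary_holds`, rc 0 — closes both after renaming), and the crux
dictionary inside `stub_reduction` (`D_jk = blkFlow 2 (C2 j k)`, `q_a = blkFlow 3 (C3 a)`) is the
sibling's, already audited symbol by symbol (Drefute-r1 §7).

## Composition (kernel-checked, sorry-free)
`AdaptedWeightCLT_of : stub_rowSplit → stub_flowDictionary → stub_rowContraction →
stub_meanFieldDamping → stub_laggedResponse → stub_reduction → CollisionIsometryCLT.AdaptedWeightCLT`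
(`σ₀ := min (min σ_RC σ_LR) 2⁻¹`; H1 enters `stub_rowContraction`, `stub_meanFieldDamping` (rank 3) and is
offered to `stub_laggedResponse`; H2 enters `stub_meanFieldDamping`, `stub_laggedResponse`,
`stub_reduction`; the conclusion is `CruxTail` verbatim).

## Disproof used (`Cruxes/AdaptedWeightCLT/Disproof.lean`, cdisprove cycle 1: NO KILL)
§1: no `_false_without_<H>` theorem exists (`withoutDiffuse/withoutTails_of_fastMomentRelaxation`);
both hypotheses are nevertheless USED (H1 at stubs 3/4, H2 at stubs 4/5/6). Landed Negative lemmas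
(`Theorems/AdaptedWeightCLT/Negative/MechanismToys.lean`, p73057), checked stub by stub:
I1 `diffuse_rows_need_not_isotropise` — honoured: isotropy is typed as the row-contraction functional
`rc2F` of the REFLECTION-GENERATED transfer and claimed in mean along the flow, never inferred from
`ipr` (the isoBlock witness has `rc2 = const ≠ 0` but violates the Galilean row sum `Σ_k M_ik = 𝟙` of
`TransferOrthonormal`, so it is not an instance of any stub); I2 `adapted_unit_rows_need_not_centre` —
honoured: no CLT, no centring of an adapted sum; the adapted content sits in `SEL + INT` and is PRICED
(signed, lagged), not wished to zero (the original card's `INT → 0` is gone, triage r1-1/r1-2);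
S3 `reflectVel_of_inner_eq_zero` — planar normals violate H1 and the one-step non-degeneracy named in
stub 3 alike; S4 `one_reflection_covariance` (`θᵢ𝟙 + (θⱼ−θᵢ)ωωᵀ`) — this is a `SEL`-type term
(different ancestor temperatures seen through one row): it is in the priced functional, not assumed
small; §2/§4 tightness (`ipr_of_collisionCount_eq_zero`, `3 = 2 + 1`) — consistent with the zero-window
convention (`M = 𝟙`, `MF = Blk`, `SEL = INT = 0`).
-/

namespace Summit.AtomisticToContinuum.HydrodynamicLimit.Cruxes.AdaptedWeightCLT.MomentTransportIsotropyParity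

open scoped BigOperators Topology Classical MeasureTheory ENNReal InnerProductSpace
open Filter Set MeasureTheory

noncomputable section

/-! ## Shared vocabulary (verbatim copies of the sibling line `contact-source-duhamel`, same names) -/

abbrev T3 : Type := UnitAddTorus (Fin 3)
/-- Velocity space `ℝ³`. -/
abbrev V3 : Type := EuclideanSpace ℝ (Fin 3)
/-- Phase space of `N + 1` spheres on `𝕋³` (the crux's configuration type). -/
abbrev Cfg (N : ℕ) : Type := Literature.Analysis.FluidPDE.Config (N + 1) (Fin 3) T3
/-- Velocity fields of `N + 1` spheres. -/
abbrev Vel (N : ℕ) : Type := Fin (N + 1) → V3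
/-- A hard-sphere flow of `N + 1` spheres of diameter `hsDiameter σ N` on `𝕋³`. -/
abbrev Flow (σ : ℝ) (N : ℕ) : Type :=
  Literature.Analysis.FluidPDE.HardSphereFlow (Literature.Analysis.FluidPDE.Torus.geometry (Fin 3))
    (Literature.MathematicalPhysics.KineticTheory.hsDiameter σ N) (N + 1)
/-- Families of hard-sphere flows at reduced density `σ` (the crux's `Φ`). -/
abbrev Flows (σ : ℝ) : Type := (N : ℕ) → Flow σ N
/-- `3 × 3` real matrices as functions. -/
abbrev Mat3 : Type := Fin 3 → Fin 3 → ℝ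
/-- Rank-`r` tensors on `ℝ³` as functions of a multi-index `Fin r → Fin 3` (`r = 2`: the stress
channel, `r = 3`: the heat-flux channel). -/
abbrev Tens (r : ℕ) : Type := (Fin r → Fin 3) → ℝ

/-- The pre-collisional configuration ending the `k`-th free flight of the Alexander construction
started at `y` (the crux's `pre k`, verbatim). -/
def pre (σ : ℝ) (N : ℕ) (y : Cfg N) (k : ℕ) : Cfg N :=
  Literature.Analysis.FluidPDE.freeFlight (Literature.Analysis.FluidPDE.Torus.geometry (Fin 3))
    (Literature.Analysis.FluidPDE.Alexander.freeExitTime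
      (Literature.Analysis.FluidPDE.Torus.geometry (Fin 3))
      (Literature.MathematicalPhysics.KineticTheory.hsDiameter σ N)
      (Literature.Analysis.FluidPDE.Alexander.stateAfter
        (Literature.Analysis.FluidPDE.Torus.geometry (Fin 3))
        (Literature.MathematicalPhysics.KineticTheory.hsDiameter σ N) y k)).toReal
    (Literature.Analysis.FluidPDE.Alexander.stateAfter
      (Literature.Analysis.FluidPDE.Torus.geometry (Fin 3))
      (Literature.MathematicalPhysics.KineticTheory.hsDiameter σ N) y k)

/-- One fold step of the crux's transfer: the velocity part of `collidePair` at the realised incoming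
pair of `pre k` (the identity if there is none), applied to a velocity field `W` placed at the positions
of `pre k` (verbatim the crux's `fun W' k => dite …`). -/
def stepMap (σ : ℝ) (N : ℕ) (y : Cfg N) (k : ℕ) (W : Vel N) : Vel N :=
  @dite (Fin (N + 1) → EuclideanSpace ℝ (Fin 3))
    (Literature.Analysis.FluidPDE.Alexander.incomingPairs
      (Literature.Analysis.FluidPDE.Torus.geometry (Fin 3))
      (Literature.MathematicalPhysics.KineticTheory.hsDiameter σ N) (pre σ N y k)).Nonempty
    (Classical.propDecidable _)
    (fun h => fun i => (Literature.Analysis.FluidPDE.collidePair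
      (Literature.Analysis.FluidPDE.Torus.geometry (Fin 3)) h.some.1 h.some.2
      (fun j => ((pre σ N y k j).1, W j)) i).2)
    (fun _ => W)

/-- The transfer after the first `m` fold steps; the crux's `M N y Δ W` is
`transferSteps σ N y (steps σ N y Δ) W`. -/
def transferSteps (σ : ℝ) (N : ℕ) (y : Cfg N) (m : ℕ) (W : Vel N) : Vel N :=
  (List.range m).foldl (fun W' k => stepMap σ N y k W') W

/-- The number of fold steps whose collision instant lies in the closed window `[0, s]` (the crux's
`collisionCount`). -/
def steps (σ : ℝ) (N : ℕ) (y : Cfg N) (s : ℝ) : ℕ :=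
  Literature.Analysis.FluidPDE.Alexander.collisionCount
    (Literature.Analysis.FluidPDE.Torus.geometry (Fin 3))
    (Literature.MathematicalPhysics.KineticTheory.hsDiameter σ N) y s

/-- The crux's mean inverse participation ratio `ipr N y Δ` with its `let M` written as
`transferSteps … (steps …)` (so that H1 is `DiffuseAt` definitionally). -/
def iprF (σ : ℝ) (N : ℕ) (y : Cfg N) (Δ : ℝ) : ℝ :=
  ((N + 1 : ℕ) : ℝ)⁻¹ * ∑ i : Fin (N + 1), ∑ k : Fin (N + 1),
    (∑ a : Fin 3, ‖transferSteps σ N y (steps σ N y Δ)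
      (Pi.single k (EuclideanSpace.single a (1 : ℝ))) i‖ ^ 2) ^ 2

/-- The velocities after `m` fold steps: the transfer applied to the velocities of `y` itself (on good
data these are the actual pre-collisional velocities of step `m`, `stub_flowDictionary`). -/
def velAfter (σ : ℝ) (N : ℕ) (y : Cfg N) (m : ℕ) : Vel N :=
  transferSteps σ N y m (fun i => (y i).2)

/-- The rank-`r` power `y^{⊗r}` of a vector. -/
def tpow (r : ℕ) (y : V3) : Tens r := fun idx => ∏ s : Fin r, y (idx s)

/-- The action `P^{⊗r}` of a matrix on all slots of a rank-`r` tensor. -/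
def mapT {r : ℕ} (P : Mat3) (T : Tens r) : Tens r :=
  fun idx => ∑ idx' : Fin r → Fin 3, (∏ s : Fin r, P (idx s) (idx' s)) * T idx'

/-- The Euclidean pairing of two rank-`r` tensors. -/
def pairT {r : ℕ} (C T : Tens r) : ℝ := ∑ idx : Fin r → Fin 3, C idx * T idx

/-- The squared Frobenius norm of a rank-`r` tensor. -/
def normSqT {r : ℕ} (T : Tens r) : ℝ := ∑ idx : Fin r → Fin 3, T idx ^ 2

/-- The coordinate vector `e_p`. -/
def baseV (p : Fin 3) : V3 := EuclideanSpace.single p (1 : ℝ)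
/-- The six probe directions `(e_p + e_q)/‖e_p + e_q‖` (`e_p` for `p = q`): their rank-one squares span
the symmetric matrices. -/
def dirV (p q : Fin 3) : V3 := (‖baseV p + baseV q‖)⁻¹ • (baseV p + baseV q)

/-- The traceless rank-2 tests `E_{jk} − δ_{jk} 𝟙/3`: paired with `Σ_i w_i y_i ⊗ y_i /(N+1)` they return
the crux's `D … j k` exactly. -/
def C2 (j k : Fin 3) : Tens 2 :=
  fun idx => (if idx 0 = j ∧ idx 1 = k then 1 else 0) - (if j = k ∧ idx 0 = idx 1 then 1 / 3 else 0)
/-- The rank-3 tests `½ δ_{a·} δ_{··}`: `⟨C3 a, y^{⊗3}⟩ = ½ y_a |y|²`, so they return the components of the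
crux's heat flux `q`. -/
def C3 (a : Fin 3) : Tens 3 :=
  fun idx => if idx 0 = a ∧ idx 1 = idx 2 then 1 / 2 else 0

/-- The LINE WINDOW `Δℓ_N = (N+1)^{-1/3} log(N+2)`: admissible (`→ 0`, `Δℓ_N (N+1)^{1/3} → ∞`) and short
enough for the initial layer (`N^{4γ} Δℓ_N → 0` for `γ ≤ 1/15`). -/
def Δℓ (N : ℕ) : ℝ := (((N : ℝ) + 1) ^ (-(1 : ℝ) / 3)) * Real.log ((N : ℝ) + 2)
/-- The window length used at time `s`: `Δℓ_N` for `s ≥ Δℓ_N`, and `0` in the initial layer `s < Δℓ_N`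
(no negative times are ever used). -/
def winLen (N : ℕ) (s : ℝ) : ℝ := if s < Δℓ N then 0 else Δℓ N

/-- The window-start configuration `Φ_{s − winLen} z`. -/
def winStart (σ : ℝ) (N : ℕ) (Φ : Flow σ N) (s : ℝ) (z : Cfg N) : Cfg N := Φ.flow (s - winLen N s) z

/-- The block weights at `(s, x)`: `w_i = φ_N(x_i(s) − x)` (positions at the FINAL time `s`). -/
def wgt (σ : ℝ) (N : ℕ) (Φ : Flow σ N) (φ : ℕ → T3 → ℝ) (s : ℝ) (z : Cfg N) (x : T3) : Fin (N + 1) → ℝ :=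
  fun i => φ N ((Φ.flow s z i).1 - x)

/-- The block velocity `ū = m̄/ρ̄` at `(s, x)` (verbatim the crux's `ub`). -/
def ubar (σ : ℝ) (N : ℕ) (Φ : Flow σ N) (φ : ℕ → T3 → ℝ) (s : ℝ) (z : Cfg N) (x : T3) : V3 :=
  (Literature.MathematicalPhysics.KineticTheory.empiricalDensityField (Φ.flow s z) (fun y => φ N (y - x)))⁻¹ •
    Literature.MathematicalPhysics.KineticTheory.empiricalMomentumField (Φ.flow s z) (fun y => φ N (y - x))

/-- The block moment of rank `r` at `(s, x)` read off the FLOW velocities: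
`(N+1)⁻¹ Σ_i φ_N(x_i(s) − x) ⟨C, (v_i(s) − ū(s,x))^{⊗r}⟩`; for `C = C2 j k` this is the crux's
`D N s z x j k`, for `C = C3 a` the `a`-component of the crux's `q N s z x`. -/
def blkFlow (r : ℕ) (σ : ℝ) (N : ℕ) (Φ : Flow σ N) (φ : ℕ → T3 → ℝ) (s : ℝ) (z : Cfg N) (x : T3)
    (C : Tens r) : ℝ :=
  ((N + 1 : ℕ) : ℝ)⁻¹ * ∑ i : Fin (N + 1),
    wgt σ N Φ φ s z x i * pairT C (tpow r ((Φ.flow s z i).2 - ubar σ N Φ φ s z x))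

/-- `|D|² + |q|²` at `(s, x)` in tensor form: `Σ_{jk} blkFlow(C2 j k)² + Σ_a blkFlow(C3 a)²`. -/
def DefectSq (σ : ℝ) (N : ℕ) (Φ : Flow σ N) (φ : ℕ → T3 → ℝ) (s : ℝ) (z : Cfg N) (x : T3) : ℝ :=
  (∑ j : Fin 3, ∑ k : Fin 3, blkFlow 2 σ N Φ φ s z x (C2 j k) ^ 2) +
    ∑ a : Fin 3, blkFlow 3 σ N Φ φ s z x (C3 a) ^ 2

/-! ## The blocks of the coherent transfer and the one-window multilinear expansion -/

/-- The `3 × 3` block `M_ik` of the crux's transfer after `m` fold steps of the Alexander construction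
started at `y`: entry `(a, b)` = the `a`-component of the velocity particle `i` receives from the unit
impulse `e_b` placed on particle `k` (linearity of the fold, `stub_rowSplit`, makes this THE matrix of
the transfer: `(transferSteps m W) i = Σ_k M_ik W_k`). -/
def blockM (σ : ℝ) (N : ℕ) (y : Cfg N) (m : ℕ) (i k : Fin (N + 1)) : Mat3 :=
  fun a b => (transferSteps σ N y m (Pi.single k (EuclideanSpace.single b (1 : ℝ))) i) a

/-- Matrix × vector, `(P v)_a = Σ_b P_{ab} v_b`. -/
def mv (P : Mat3) (v : V3) : Fin 3 → ℝ := fun a => ∑ b : Fin 3, P a b * v b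

/-- The general term `⊗_{s<r} M_{i k_s} a_{k_s}` of the multilinear expansion of `(Σ_k M_ik a_k)^{⊗r}`
(row blocks `Mrow k = M_ik`, ancestor velocities `a`, multi-index `ks`). -/
def multiT (r : ℕ) {N : ℕ} (Mrow : Fin (N + 1) → Mat3) (a : Fin (N + 1) → V3)
    (ks : Fin r → Fin (N + 1)) : Tens r :=
  fun idx => ∏ s : Fin r, mv (Mrow (ks s)) (a (ks s)) (idx s)

/-- Diagonal multi-indices (all ancestors equal). -/
def IsDiag {r n : ℕ} (ks : Fin r → Fin n) : Prop := ∀ s s' : Fin r, ks s = ks s'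

/-- `DIAG_i = Σ_k M_ik^{⊗r} a_k^{⊗r}`: the diagonal (single-ancestor) part of the expansion, written with
the shared `mapT`/`tpow` (`mapT (Mrow k) (tpow r (a k)) = multiT … (fun _ => k)`, `Fintype.prod_sum`). -/
def diagT (r : ℕ) {N : ℕ} (Mrow : Fin (N + 1) → Mat3) (a : Fin (N + 1) → V3) : Tens r :=
  ∑ k : Fin (N + 1), mapT (Mrow k) (tpow r (a k))

/-- `INT_i`: the INTERFERENCE part — the sum of the expansion over the NON-diagonal multi-indices
(rank 2: `Σ_{k ≠ l} M_ik a_k ⊗ M_il a_l`; rank 3: all triples not all equal). -/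
def intT (r : ℕ) {N : ℕ} (Mrow : Fin (N + 1) → Mat3) (a : Fin (N + 1) → V3) : Tens r :=
  ∑ ks ∈ (Finset.univ : Finset (Fin r → Fin (N + 1))).filter (fun ks => ¬ IsDiag ks),
    multiT r Mrow a ks

/-- The ROW TRANSPORT `𝒯_i^{(r)} : S ↦ Σ_k M_ik^{⊗r} S` of ONE tensor `S` placed at every ancestor
(rank 2: `S ↦ Σ_k M_ik S M_ikᵀ`; maps `𝟙 ↦ Σ_k M_ik M_ikᵀ = 𝟙` by row orthonormality). -/
def rowT (r : ℕ) {N : ℕ} (Mrow : Fin (N + 1) → Mat3) (S : Tens r) : Tens r :=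
  ∑ k : Fin (N + 1), mapT (Mrow k) S

/-! ## Row rotational contraction functional (rank 2, traceless sector) -/

/-- The traceless part of a rank-2 tensor. -/
def tl2 (T : Tens 2) : Tens 2 :=
  fun idx => T idx - (if idx 0 = idx 1 then (∑ c : Fin 3, T (fun _ => c)) / 3 else 0)

/-- The traceless probes `tl (d_pq ⊗ d_pq)` over the six directions `d_pq = (e_p + e_q)/‖e_p + e_q‖`
(their span is the whole 5-dimensional traceless symmetric sector). -/
def probe (p q : Fin 3) : Tens 2 := tl2 (tpow 2 (dirV p q))

/-- Row rotational-contraction defect of one row (blocks `Mrow`): `Σ_{pq} ‖tl 𝒯_i(probe_pq)‖²` — zero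
iff the row transport kills the traceless symmetric sector (`κ_i = 0`), `= Σ_{pq}‖probe_pq‖²` for the
identity row and for the Disproof's isoBlock row (`𝒯 = id`, `κ = 1`). Bounded (`‖𝒯_i S‖ ≤ 3‖S‖`). -/
def rc2Row {N : ℕ} (Mrow : Fin (N + 1) → Mat3) : ℝ :=
  ∑ p : Fin 3, ∑ q : Fin 3, normSqT (tl2 (rowT 2 Mrow (probe p q)))

/-- The mean row rotational-contraction defect of the transfer over the window `[0, Δ]` restarted at
`y`: `(N+1)⁻¹ Σ_i rc2Row(M_i·)` — the rank-2 ISOTROPY functional of this line (the typed form of the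
card's contraction constant `κ`, on the COHERENT `M`; row-side twin of the sibling line's `cd2`). -/
def rc2F (σ : ℝ) (N : ℕ) (y : Cfg N) (Δ : ℝ) : ℝ :=
  ((N + 1 : ℕ) : ℝ)⁻¹ * ∑ i : Fin (N + 1), rc2Row (fun k => blockM σ N y (steps σ N y Δ) i k)

/-! ## Influence weights, reference past tensor, the MF / SEL / INT window functionals
(window start `y`, `m` fold steps, block weights `w`, shift `u`) -/

/-- The influence weight `ν_ik = ‖M_ik‖_F²/3` (doubly stochastic: `Σ_k ν_ik = 1 = Σ_i ν_ik`). -/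
def infl (σ : ℝ) (N : ℕ) (y : Cfg N) (m : ℕ) (i k : Fin (N + 1)) : ℝ :=
  (∑ a : Fin 3, ∑ b : Fin 3, blockM σ N y m i k a b ^ 2) / 3

/-- The block's influence on ancestor `k`: `W_k = Σ_i w_i ν_ik` (`Σ_k W_k = Σ_i w_i`). -/
def anW (σ : ℝ) (N : ℕ) (y : Cfg N) (m : ℕ) (w : Fin (N + 1) → ℝ) (k : Fin (N + 1)) : ℝ :=
  ∑ i : Fin (N + 1), w i * infl σ N y m i k

/-- The REFERENCE PAST TENSOR `S̄^{(r)}`: the influence-weighted average of the shifted ancestor powers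
`a_k^{⊗r}`, `a_k = (y k).2 − u` (`0/0 := 0` on a block of zero mass, where every functional vanishes). -/
def refT (r : ℕ) (σ : ℝ) (N : ℕ) (y : Cfg N) (m : ℕ) (w : Fin (N + 1) → ℝ) (u : V3) : Tens r :=
  fun idx => (∑ k : Fin (N + 1), anW σ N y m w k * tpow r ((y k).2 - u) idx) /
    (∑ k : Fin (N + 1), anW σ N y m w k)

/-- `DIAG` tested: `(N+1)⁻¹ Σ_i w_i ⟨C, Σ_k M_ik^{⊗r} a_k^{⊗r}⟩`. -/
def diagF (r : ℕ) (σ : ℝ) (N : ℕ) (y : Cfg N) (m : ℕ) (w : Fin (N + 1) → ℝ) (u : V3) (C : Tens r) : ℝ :=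
  ((N + 1 : ℕ) : ℝ)⁻¹ * ∑ i : Fin (N + 1),
    w i * pairT C (diagT r (fun k => blockM σ N y m i k) (fun k => (y k).2 - u))

/-- `INT` tested: `(N+1)⁻¹ Σ_i w_i ⟨C, INT_i⟩` — the interference functional. -/
def intF (r : ℕ) (σ : ℝ) (N : ℕ) (y : Cfg N) (m : ℕ) (w : Fin (N + 1) → ℝ) (u : V3) (C : Tens r) : ℝ :=
  ((N + 1 : ℕ) : ℝ)⁻¹ * ∑ i : Fin (N + 1),
    w i * pairT C (intT r (fun k => blockM σ N y m i k) (fun k => (y k).2 - u))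

/-- `MF` tested: `(N+1)⁻¹ Σ_i w_i ⟨C, 𝒯_i^{(r)}(S̄^{(r)})⟩` — the row transport of the common reference
past tensor (the only term a velocity-BLIND, homogeneous past would produce). -/
def mfF (r : ℕ) (σ : ℝ) (N : ℕ) (y : Cfg N) (m : ℕ) (w : Fin (N + 1) → ℝ) (u : V3) (C : Tens r) : ℝ :=
  ((N + 1 : ℕ) : ℝ)⁻¹ * ∑ i : Fin (N + 1),
    w i * pairT C (rowT r (fun k => blockM σ N y m i k) (refT r σ N y m w u))

/-- `SEL := DIAG − MF` tested — the selection covariance functional (adapted row weights vs ancestor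
tensors; vanishes for a homogeneous past and, in mean, at equilibrium by `Σ_k M_ik M_ikᵀ = 𝟙`). -/
def selF (r : ℕ) (σ : ℝ) (N : ℕ) (y : Cfg N) (m : ℕ) (w : Fin (N + 1) → ℝ) (u : V3) (C : Tens r) : ℝ :=
  diagF r σ N y m w u C - mfF r σ N y m w u C

/-! ## Flow-side functionals at `(s, x)`: the fold restarted at `winStart` with `m = steps (winLen N s)`
steps, weights `wgt` (final positions), shift `ubar` (the crux's `ū(s, x)`) -/

/-- `MF_b(s, x)`. -/
def mfFlow (r : ℕ) (σ : ℝ) (N : ℕ) (Φ : Flow σ N) (φ : ℕ → T3 → ℝ) (s : ℝ) (z : Cfg N) (x : T3)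
    (C : Tens r) : ℝ :=
  mfF r σ N (winStart σ N Φ s z) (steps σ N (winStart σ N Φ s z) (winLen N s)) (wgt σ N Φ φ s z x)
    (ubar σ N Φ φ s z x) C

/-- `SEL_b(s, x)`. -/
def selFlow (r : ℕ) (σ : ℝ) (N : ℕ) (Φ : Flow σ N) (φ : ℕ → T3 → ℝ) (s : ℝ) (z : Cfg N) (x : T3)
    (C : Tens r) : ℝ :=
  selF r σ N (winStart σ N Φ s z) (steps σ N (winStart σ N Φ s z) (winLen N s)) (wgt σ N Φ φ s z x)
    (ubar σ N Φ φ s z x) C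

/-- `INT_b(s, x)`. -/
def intFlow (r : ℕ) (σ : ℝ) (N : ℕ) (Φ : Flow σ N) (φ : ℕ → T3 → ℝ) (s : ℝ) (z : Cfg N) (x : T3)
    (C : Tens r) : ℝ :=
  intF r σ N (winStart σ N Φ s z) (steps σ N (winStart σ N Φ s z) (winLen N s)) (wgt σ N Φ φ s z x)
    (ubar σ N Φ φ s z x) C

/-- `Σ_tests MF²` at `(s, x)` (both channels). -/
def MfSq (σ : ℝ) (N : ℕ) (Φ : Flow σ N) (φ : ℕ → T3 → ℝ) (s : ℝ) (z : Cfg N) (x : T3) : ℝ :=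
  (∑ j : Fin 3, ∑ k : Fin 3, mfFlow 2 σ N Φ φ s z x (C2 j k) ^ 2) +
    ∑ a : Fin 3, mfFlow 3 σ N Φ φ s z x (C3 a) ^ 2

/-- The RESPONSE functional `RESP(s, x) = Σ_b Blk_b · (SEL_b + INT_b)`: the non-mean-field part of the
one-window transported block moments, correlated with the PRESENT block moments (`Blk_b = blkFlow`,
i.e. `D_jk`, `q_a` after the dictionary). -/
def Resp (σ : ℝ) (N : ℕ) (Φ : Flow σ N) (φ : ℕ → T3 → ℝ) (s : ℝ) (z : Cfg N) (x : T3) : ℝ :=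
  (∑ j : Fin 3, ∑ k : Fin 3, blkFlow 2 σ N Φ φ s z x (C2 j k) *
      (selFlow 2 σ N Φ φ s z x (C2 j k) + intFlow 2 σ N Φ φ s z x (C2 j k))) +
    ∑ a : Fin 3, blkFlow 3 σ N Φ φ s z x (C3 a) *
      (selFlow 3 σ N Φ φ s z x (C3 a) + intFlow 3 σ N Φ φ s z x (C3 a))

/-- The LAGGED flux defect `|D|² + |q|²` at the window start `s − Δℓ_N` (same `x`); `0` in the initial
layer `s < Δℓ_N` (so that `∫₀ᵗ lagDefect ≤ ∫₀ᵗ DefectSq` with no layer term). -/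
def lagDefect (σ : ℝ) (N : ℕ) (Φ : Flow σ N) (φ : ℕ → T3 → ℝ) (s : ℝ) (z : Cfg N) (x : T3) : ℝ :=
  if s < Δℓ N then 0 else DefectSq σ N Φ φ (s - Δℓ N) z x

/-! ## The statements of the line -/

/-- Continuous, positive profiles (the crux's hypotheses on `a₀, θ₀, u₀`). -/
def NiceProfiles (a₀ θ₀ : T3 → ℝ) (u₀ : T3 → V3) : Prop :=
  Continuous a₀ ∧ Continuous θ₀ ∧ Continuous u₀ ∧ (∀ x, 0 < a₀ x) ∧ (∀ x, 0 < θ₀ x)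

/-- Admissible kernel families (verbatim the crux's kernel hypothesis at `(γ, C, φ)`). -/
def AdmissibleKernel (γ C : ℝ) (φ : ℕ → T3 → ℝ) : Prop :=
  (∀ N, Literature.Analysis.FunctionSpaces.Torus.IsSmooth (φ N)) ∧ (∀ N y, 0 ≤ φ N y) ∧ (∀ N, ∫ y, φ N y = 1) ∧ (∀ (N : ℕ) y, ((N : ℝ) + 1) ^ (-γ) ≤ Literature.Analysis.FluidPDE.Torus.euclidDist y 0 → φ N y = 0) ∧ (∀ (N : ℕ) y, φ N y ≤ C * ((N : ℝ) + 1) ^ (3 * γ)) ∧ (∀ (N : ℕ) y, ‖Literature.Analysis.FunctionSpaces.Torus.gradient (φ N) y‖ ≤ C * ((N : ℝ) + 1) ^ (4 * γ))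

/-- **ONE-WINDOW ROW SPLIT** (exact algebra of the typed fold, all ranks `r ≥ 1`; false at `r = 0`,
where it reads `1 = N + 1`): for every `N`, window start `y`, shift `u`, number of fold steps `m` and
particle `i`, `(velAfter m i − u)^{⊗r} = DIAG_i + INT_i` with the blocks `M_ik = blockM … m i k` and the
ancestors `a_k = (y k).2 − u`. Content: the fold is `ℝ`-linear in the velocity field and FIXES CONSTANT
fields (Galilean invariance of `reflectVel`), so `velAfter m i − u = Σ_k M_ik a_k`; then expand. -/
def RowSplitIdentity (σ : ℝ) : Prop :=
  ∀ (r N : ℕ) (y : Cfg N) (u : V3) (m : ℕ), 0 < r → ∀ i : Fin (N + 1),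
    tpow r (velAfter σ N y m i - u) =
      diagT r (fun k => blockM σ N y m i k) (fun k => (y k).2 - u) +
        intT r (fun k => blockM σ N y m i k) (fun k => (y k).2 - u)

/-- **BLOCK ORTHONORMALITY** of the transfer (exact, for EVERY configuration and step count — each fold
step is the identity or `reflectVel` at a fixed normal, a linear isometry fixing constants): ROW
`Σ_k M_ik M_ikᵀ = 𝟙` (the transfer is orthogonal: `M Mᵀ = 1`), COLUMN `Σ_i M_ikᵀ M_il = δ_kl 𝟙`
(`Mᵀ M = 1`, = the route's support `TransferIsometry` polarised), GALILEAN `Σ_k M_ik = 𝟙`. -/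
def TransferOrthonormal (σ : ℝ) : Prop :=
  ∀ (N : ℕ) (y : Cfg N) (m : ℕ),
    (∀ (i : Fin (N + 1)) (a b : Fin 3),
        ∑ k : Fin (N + 1), ∑ c : Fin 3, blockM σ N y m i k a c * blockM σ N y m i k b c =
          if a = b then 1 else 0) ∧
      (∀ (k l : Fin (N + 1)) (a b : Fin 3),
        ∑ i : Fin (N + 1), ∑ c : Fin 3, blockM σ N y m i k c a * blockM σ N y m i l c b =
          if k = l ∧ a = b then 1 else 0) ∧
      (∀ (i : Fin (N + 1)) (a b : Fin 3),
        ∑ k : Fin (N + 1), blockM σ N y m i k a b = if a = b then 1 else 0)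

/-- **FLOW DICTIONARY** (the fold IS the flow, almost surely and uniformly in time) — LITERALLY the
sibling line's `FlowDictionary` over the shared vocabulary (= the route's support item
`TransferRepresentsFlow`, stmt-12952, uniform in `s`; PROVED by the drefute seat,
`DrefuteFoldDictionary.flowDictionary_holds`, modulo the namespace of the copied definitions). -/
def FlowDictionary (σ : ℝ) : Prop :=
  ∀ (N : ℕ) (Φ : Flow σ N),
    ∀ᵐ z ∂(Literature.Analysis.FluidPDE.liouville (Literature.Analysis.FluidPDE.Torus.geometry (Fin 3))
      (N + 1) (Literature.MathematicalPhysics.KineticTheory.hsDiameter σ N)),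
      ∀ s Δ : ℝ, 0 ≤ Δ →
        (fun i => (Φ.flow (s + Δ) z i).2) = velAfter σ N (Φ.flow s z) (steps σ N (Φ.flow s z) Δ)

/-- H1 at `(σ, profiles, Φ)`: verbatim the crux's first hypothesis (= the conclusion of
`DiffuseBackwardInfluence`), its `let M; let ipr` written as the shared `iprF`. -/
def DiffuseAt (σ : ℝ) (a₀ θ₀ : T3 → ℝ) (u₀ : T3 → V3) (Φ : Flows σ) : Prop :=
  ∀ Δ : ℕ → ℝ, (∀ N, 0 < Δ N) → Tendsto Δ atTop (𝓝 0) → Tendsto (fun N : ℕ => Δ N * ((N + 1 : ℕ) : ℝ) ^ ((1 : ℝ) / 3)) atTop atTop → ∀ t : ℝ, 0 < t → Tendsto (fun N : ℕ => ∫⁻ z, ENNReal.ofReal (iprF σ N ((Φ N).flow (t - Δ N) z) (Δ N)) ∂(Literature.MathematicalPhysics.KineticTheory.localGibbsLaw σ a₀ u₀ θ₀ N (Φ N))) atTop (𝓝 0)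

/-- H2 at `(σ, profiles, Φ)`: verbatim the crux's second hypothesis (= `AprioriBounds` (i)). -/
def TailsAt (σ : ℝ) (a₀ θ₀ : T3 → ℝ) (u₀ : T3 → V3) (Φ : Flows σ) : Prop :=
  ∀ t : ℝ, 0 < t → ∃ lam Cexp : ℝ, 0 < lam ∧ Tendsto (fun N : ℕ => Literature.MathematicalPhysics.KineticTheory.localGibbsLaw σ a₀ u₀ θ₀ N (Φ N) {z | Cexp < ∫ s in Icc 0 t, ∫ y, Real.exp (lam * ‖y.2‖ ^ 2) ∂(Literature.Analysis.FluidPDE.empiricalMeasure ((Φ N).flow s z))}) atTop (𝓝 0)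

/-- The conclusion of the crux at `(σ, profiles, Φ)`: verbatim its text from `∀ (γ C : ℝ) (φ …)` on
(the `let ρb mb ub D q` telescope included), so that the composition closes by `exact`. -/
def CruxTail (σ : ℝ) (a₀ θ₀ : T3 → ℝ) (u₀ : T3 → V3) (Φ : Flows σ) : Prop :=
  ∀ (γ C : ℝ) (φ : ℕ → (UnitAddTorus (Fin 3)) → ℝ), 0 < γ → γ ≤ 1 / 15 → ((∀ N, Literature.Analysis.FunctionSpaces.Torus.IsSmooth (φ N)) ∧ (∀ N y, 0 ≤ φ N y) ∧ (∀ N, ∫ y, φ N y = 1) ∧ (∀ (N : ℕ) y, ((N : ℝ) + 1) ^ (-γ) ≤ Literature.Analysis.FluidPDE.Torus.euclidDist y 0 → φ N y = 0) ∧ (∀ (N : ℕ) y, φ N y ≤ C * ((N : ℝ) + 1) ^ (3 * γ)) ∧ (∀ (N : ℕ) y, ‖Literature.Analysis.FunctionSpaces.Torus.gradient (φ N) y‖ ≤ C * ((N : ℝ) + 1) ^ (4 * γ))) → let ρb := fun (N : ℕ) (s : ℝ) z (x : UnitAddTorus (Fin 3)) => Literature.MathematicalPhysics.KineticTheory.empiricalDensityField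 ((Φ N).flow s z) (fun y => φ N (y - x)); let mb := fun (N : ℕ) (s : ℝ) z (x : UnitAddTorus (Fin 3)) => Literature.MathematicalPhysics.KineticTheory.empiricalMomentumField ((Φ N).flow s z) (fun y => φ N (y - x)); let ub := fun (N : ℕ) (s : ℝ) z (x : UnitAddTorus (Fin 3)) => (ρb N s z x)⁻¹ • mb N s z x; let D := fun (N : ℕ) (s : ℝ) z (x : UnitAddTorus (Fin 3)) (j k : Fin 3) => (∫ y, φ N (y.1 - x) * ((y.2 j - ub N s z x j) * (y.2 k - ub N s z x k)) ∂(Literature.Analysis.FluidPDE.empiricalMeasure ((Φ N).flow s z))) - (if j = k then (∑ l : Fin 3, ∫ y, φ N (y.1 - x) * (y.2 l - ub N s z x l) ^ 2 ∂(Literature.Analysis.FluidPDE.empiricalMeasure ((Φ N).flow s z))) / 3 else 0); let q := fun (N : ℕ) (s : ℝ) z (x : UnitAddTorus (Fin 3)) => ∫ y, (φ N (y.1 - x) * ‖y.2 - ub N s z x‖ ^ 2 / 2) • (y.2 - ub N s z x) ∂(Literature.Analysis.FluidPDE.empiricalMeasure ((Φ N).flow s z)); ∀ t : ℝ, 0 <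 t → ∀ δ : ℝ, 0 < δ → Tendsto (fun N : ℕ => Literature.MathematicalPhysics.KineticTheory.localGibbsLaw σ a₀ u₀ θ₀ N (Φ N) {z | δ < ∫ s in Icc 0 t, ∫ x, ((∑ j, ∑ k, D N s z x j k ^ 2) + ‖q N s z x‖ ^ 2)}) atTop (𝓝 0)

/-- ROW ROTATIONAL CONTRACTION ALONG THE LINE WINDOW at `(σ, profiles, Φ)`: for every `t > 0` the
local-Gibbs mean of `rc2F` of the transfer over `[t − Δℓ_N, t]` tends to `0` (the coherent row
transport kills the traceless symmetric rank-2 sector). -/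
def RCAlongAt (σ : ℝ) (a₀ θ₀ : T3 → ℝ) (u₀ : T3 → V3) (Φ : Flows σ) : Prop :=
  ∀ t : ℝ, 0 < t → Tendsto (fun N : ℕ => ∫⁻ z, ENNReal.ofReal
      (rc2F σ N ((Φ N).flow (t - Δℓ N) z) (Δℓ N))
    ∂(Literature.MathematicalPhysics.KineticTheory.localGibbsLaw σ a₀ u₀ θ₀ N (Φ N))) atTop (𝓝 0)

/-- MEAN-FIELD PAST DAMPED at `(σ, profiles, Φ)`: for every admissible kernel family, `t > 0`, `δ > 0`,
`P(∫₀ᵗ ∫ₓ Σ_tests MF² > δ) → 0` (initial layer included: there `MF = Blk`). -/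
def MFSmallAt (σ : ℝ) (a₀ θ₀ : T3 → ℝ) (u₀ : T3 → V3) (Φ : Flows σ) : Prop :=
  ∀ (γ C : ℝ) (φ : ℕ → T3 → ℝ), 0 < γ → γ ≤ 1 / 15 → AdmissibleKernel γ C φ →
    ∀ t : ℝ, 0 < t → ∀ δ : ℝ, 0 < δ →
      Tendsto (fun N : ℕ => Literature.MathematicalPhysics.KineticTheory.localGibbsLaw σ a₀ u₀ θ₀ N (Φ N)
        {z | δ < ∫ s in Icc 0 t, ∫ x, MfSq σ N (Φ N) φ s z x}) atTop (𝓝 0)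

/-- LAGGED SIGNED RESPONSE (the chaos statement of the line) at `(σ, profiles, Φ)`: for every
admissible kernel family and `t > 0` there is `c < 1` such that for every `δ > 0`,
`P(∫₀ᵗ ∫ₓ RESP > c ∫₀ᵗ ∫ₓ lagDefect + δ) → 0` — the selection + interference part of the one-window
transported block moments, correlated with the present block moments, never exceeds a fraction
`c < 1` of the flux defect at the window START, up to `o(1)` (prediction: a restoring response at
every finite collision depth and window gain `→ 0`; only `c < 1` is asked). -/
def LaggedResponseAt (σ : ℝ) (a₀ θ₀ : T3 → ℝ) (u₀ : T3 → V3) (Φ : Flows σ) : Prop :=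
  ∀ (γ C : ℝ) (φ : ℕ → T3 → ℝ), 0 < γ → γ ≤ 1 / 15 → AdmissibleKernel γ C φ →
    ∀ t : ℝ, 0 < t → ∃ c : ℝ, c < 1 ∧ ∀ δ : ℝ, 0 < δ →
      Tendsto (fun N : ℕ => Literature.MathematicalPhysics.KineticTheory.localGibbsLaw σ a₀ u₀ θ₀ N (Φ N)
        {z | c * (∫ s in Icc 0 t, ∫ x, lagDefect σ N (Φ N) φ s z x) + δ <
          ∫ s in Icc 0 t, ∫ x, Resp σ N (Φ N) φ s z x}) atTop (𝓝 0)

/-! ## Registered stubs (`Holds.stub_*`, bodies `sorry`) -/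

namespace Holds

/-- STUB 1 (ONE-WINDOW ROW SPLIT + BLOCK ORTHONORMALITY, exact algebra of the typed fold, size M,
provable now). For every `σ`: (a) `RowSplitIdentity σ` and (b) `TransferOrthonormal σ`. Ingredients:
(i) a fold step is the identity or `collidePair` at the incoming pair `(i, j)` of `pre k`, whose velocity
part is `reflectVel n`, `n = sepVec xᵢ xⱼ`: `Wᵢ ↦ Wᵢ − (⟪Wᵢ − Wⱼ, n⟫/‖n‖²) n`, `Wⱼ ↦ Wⱼ + (…) n` —
`ℝ`-LINEAR in `W`, an ISOMETRY of `⊕ᵢ V3` (also at `n = 0`, where it is the identity), and the IDENTITY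
on constant fields (`Wᵢ = Wⱼ`); (ii) induction on `m` (`transferSteps_succ`, landed) gives the same three
properties for `transferSteps m`, hence `(transferSteps m W) i = Σ_k M_ik W_k` with `M_ik = blockM`
(expand `W = Σ_k Σ_b W_k(b) · Pi.single k e_b`), `velAfter m i − u = Σ_k M_ik ((y k).2 − u)`,
`Σ_k M_ik = 𝟙` (Galilean), `Mᵀ M = 1` (isometry, polarised) and `M Mᵀ = 1` (a linear isometry of a
finite-dimensional space is orthogonal); (iii) the multilinear expansion
`tpow r (Σ_k M_ik a_k) = Σ_{ks} multiT r … ks` (`Finset.prod_univ_sum`) split over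
`IsDiag ks ∨ ¬ IsDiag ks`, with `multiT … (fun _ => k) = mapT (M_ik) (tpow r (a k))`
(`Fintype.prod_sum`); at `r = 0` the split is false (`0 < r` is used to identify the diagonal sum).
Why plausible: identities; the step algebra (i)–(ii) is the `oneStep`/linearity part of the drefute
seat's `DrefuteDuhamel.lean` (PROVED for the sibling line over the same vocabulary), the scalar shadow
of the column identity is `IdeatorOneSketch.interference_trace_vanishes_scalar` (PROVED), and (b) refines
the route's support `TransferIsometry` (stmt-12951, provable-now). -/
theorem stub_rowSplit : ∀ σ : ℝ, RowSplitIdentity σ ∧ TransferOrthonormal σ := by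
  sorry

/-- STUB 2 (FLOW DICTIONARY, size M, PROVED modulo namespace). For `0 < σ < 1/2` (regular torus
geometry, `ε_N < 1/2`) the velocities along every hard-sphere flow are, Liouville-a.s. and simultaneously
for all `s` and `Δ ≥ 0`, the typed fold restarted at `Φ_s z` applied to the velocities of `Φ_s z`.
This is the sibling line's stub 2 verbatim over the shared vocabulary; the drefute seat's
`Cruxes/AdaptedWeightCLT/DrefuteFoldDictionary.lean` proves it (`flowDictionary_holds`, rc 0, axioms
propext/Classical.choice/Quot.sound: conull set `Φ.good ∩ ⋂_{q∈ℚ} Φ_q⁻¹Γ₀`, `torusFlow_ae_good_holds`,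
`IsHardSphereTrajectory.unique_holds`, `torusFlow_group_holds`, `fwdFlow_snd_eq_velAfter`) — closing
this stub is a rename of that file's copied definitions onto the landed vocabulary. -/
theorem stub_flowDictionary : ∀ σ : ℝ, 0 < σ → σ < 2⁻¹ → FlowDictionary σ := by
  sorry

/-- STUB 3 (ROW ROTATIONAL CONTRACTION from H1; size L). For all nice profiles there is `σ₀ > 0` such
that for `0 < σ < σ₀` (block orthonormality offered) and every flow family, IF the rows of the transfer
delocalise on every admissible window (H1, verbatim) THEN along the line window `Δℓ_N = (N+1)^{-1/3} log(N+2)` (admissible) the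
COHERENT row transport depolarises on the traceless rank-2 sector: `E_LG[rc2F] → 0` at every `t > 0`.
Mechanism (backward in the window): at the last own-collision of `i` (partner `j`, normal `n`,
`P = n̂n̂ᵀ`, `Q = 𝟙 − P`) the row blocks update `M_ik = Q M⁻_ik + P M⁻_jk`, so for a traceless symmetric `E`
`𝒯_i(E) = Q 𝒯⁻_i(E) Q + P 𝒯⁻_j(E) P + [Q X_ij(E) P + h.c.]`, `X_ij(E) = Σ_k M⁻_ik E M⁻_jkᵀ` (the
`E`-TWISTED ROW OVERLAP; `X_ij(𝟙) = 0` exactly for `i ≠ j` by row orthogonality). The PINCHING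
`T ↦ QTQ + PTP` removes `2(|Tn̂|² − (n̂ᵀTn̂)²) ≥ 0` from `‖T‖²`, `= (2/5)‖T‖²` on average for an isotropic
normal (`E‖QΣQ + PΣP‖_F² = (3/5)‖Σ‖_F²`, triage-checked thrice; constants `7/15 + 2/15` = Disproof S4
`one_reflection_covariance`), and removes NOTHING iff `n̂` is an eigenvector of `T`; a conditional normal
law supported on the eigenvectors of one fixed traceless `T` only swaps/fixes one velocity component, so
that component's transfer is a permutation, every row keeps a unit block and `ipr ≥ 1`: ¬H1 (the drefute
seat's one-step obstruction analysis for the sibling line's `cd2`, which is the same pinching map —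
Drefute-r1 §3; planar kernel `reflectVel_of_inner_eq_zero` = Disproof S3). So `rc2` is a supermartingale
in the own-collision count down to a floor set by the twisted overlaps of colliding pairs, whose
incoherent size is `≍ √K_ij ‖E‖` with kinship `K_ij ≤ (ipr_i + ipr_j)/2` (`IdeatorOneSketch.kinship_le_half_iprs`,
PROVED; triage r1-1 §kinship): H1 IS the floor. Why it might fail: (a) the RATE needs ONE-STEP
NON-DEGENERACY (OSN) of the conditional law of the next normal given the coarse past (pinching coefficient
`≥ c₀ > 0`, N-uniformly, along the NON-equilibrium law) — the chaotic-hypothesis-type input shared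
verbatim with the sibling line's `stub_columnDepolarisation`, with `impulse-stress-contraction` and with
the sibling crux's live line `share-nondegeneracy-one-flight`; H1 excludes the degenerate laws but gives no
rate; (b) COHERENT alignment of the twisted overlaps `X_ij(E)` across a block's colliding pairs (a
kinship-type correlation beyond `√K`; triage r1-1's toy j010481 measured `T` vs `√K` for colliding vs
random pairs) would lift the floor above H1; (c) fixed `σ`: rings inside the window renormalise the
pinching statistics by `O(σ³)` (`∃ σ₀`). What this stub buys over the sibling's `cd2`: `rc2F` is a
functional of the COHERENT `M` — the object H1 is about — so the sibling's caveat "H1 speaks of the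
coherent transfer, `cd2/cd3` of the incoherent one" does not arise; the price is the twisted-overlap
cross term (b), absent from the incoherent transport by construction. Sources: DiaconisSaloffcoste1993
(random reflections, isotropic benchmark), Porod1996 (doi:10.1214/aop/1042644708), CarlenCarvalhoLoss2014
(doi:10.1016/j.jfa.2013.08.024), `hardSphereLinearizedOp_spectralGap_holds` (tree: no slow `ℓ = 2` mode),
kit j007601/j008854 (route header: `−Δ log(ipr/9) ≈ 0.30–0.35` per collision, no plateau). -/
theorem stub_rowContraction :
    ∀ (a₀ θ₀ : T3 → ℝ) (u₀ : T3 → V3), NiceProfiles a₀ θ₀ u₀ →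
      ∃ σ₀ : ℝ, 0 < σ₀ ∧ ∀ σ : ℝ, 0 < σ → σ < σ₀ → TransferOrthonormal σ →
        ∀ Φ : Flows σ, DiffuseAt σ a₀ θ₀ u₀ Φ → RCAlongAt σ a₀ θ₀ u₀ Φ := by
  sorry

/-- STUB 4 (MEAN-FIELD DAMPING, analysis, size M/L). For nice profiles, `0 < σ < 1/2` and every flow
family: block orthonormality, row contraction along `Δℓ`, H1 (for the cubic channel) and the tails H2
imply `∫₀ᵗ∫ₓ Σ_tests MF² → 0` in probability for every admissible kernel family. Proof sketch. Rank 2,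
`s ≥ Δℓ_N`: split the reference tensor `S̄ = (tr S̄/3)𝟙 + tl S̄`; ROW ORTHONORMALITY gives
`𝒯_i(𝟙) = Σ_k M_ik M_ikᵀ = 𝟙` EXACTLY and `⟨C2 j k, 𝟙⟩ = 0` (traceless test), so
`MF_b = (N+1)⁻¹ Σ_i w_i ⟨C2, 𝒯_i(tl S̄)⟩`; expanding `tl S̄` over the probes (the six `probe p q` span the
traceless symmetric sector with uniformly bounded coefficients) and Cauchy–Schwarz,
`|MF_b| ≤ K ‖S̄‖ (N+1)⁻¹ Σ_i w_i (rc2Row_i)^{1/2}`, hence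
`∫ₓ Σ_b MF_b² ≤ K (sup_x ρ̄) ∫ₓ ‖S̄(x)‖² (N+1)⁻¹Σ_i w_i rc2Row_i dx`, with the hard-core density cap
`sup_x ρ̄ ≤ 8C/σ³` (at most `(r/ε_N + 1)³` centres at mutual distance `≥ ε_N` in a ball of radius `r`),
`‖S̄(x)‖² ≤` influence-weighted average of `|a_k|⁴` (Jensen), `∫ₓ w_i dx = 1`, `Σ_i ν_ik = 1` (doubly
stochastic influence, from the COLUMN identity), so the `x`-integral is bounded by
`K_σ [(N+1)⁻¹Σ_k |a_k|⁴ on the event max|a_k| ≤ V] × rc2F + (mass of ancestors faster than V)`; the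
`s`-integral is then `≤ K (∫ m₈ ds)^{1/2} (∫ rc2F ds)^{1/2} + tail(V)` → 0 in probability (H2 bounds every
time-integrated polynomial velocity moment and prices `V² = K' log N`; `E rc2F(s) → 0` pointwise in
`s > 0` and `rc2F ≤ 9·Σ‖probe‖² = 54`, dominated convergence in `s`; `|ū| ≤` block-average speed). Rank 3: no
isotropic part is needed — `|⟨C3 a, mapT (M_ik) S̄³⟩| ≤ ‖C3‖ ‖M_ik‖_F³ ‖S̄³‖` and
`Σ_k ‖M_ik‖_F³ ≤ (Σ_k‖M_ik‖_F²)^{1/2}(Σ_k‖M_ik‖_F⁴)^{1/2} = √3 · ipr_i^{1/2}` (row budget `3`), so the cubic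
mean field is slaved to `iprF` on the line window, i.e. to H1 (`Δℓ` is admissible: `Δℓ_N → 0`,
`Δℓ_N (N+1)^{1/3} = log(N+2) → ∞`, `Δℓ_N > 0`) — H1 IS the heat-flux lemma, as in the sibling line.
Initial layer `s < Δℓ_N` (zero window; on good orbits `steps y 0 = 0`, `M = 𝟙`, `ν_ik = δ_ik`,
`S̄ =` the block average, so `MF_b = Blk_b` exactly): `∫ₓ(|D|²+|q|²) ≤ ‖φ_N‖_∞ (m₂² + m₂m₄)` and
`∫₀^{Δℓ} m₄ ≤ Δℓ V² 2E + C_λ e^{−λV²/2} ∫₀ᵗ(N+1)⁻¹Σ e^{λ|v|²}`, so `N^{3γ} × (layer) → 0` (`3γ ≤ 1/5 < 1/3`).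
Why it might fail: bookkeeping only (Bochner measurability of the fold functionals along the flow —
`HardSphereFlowMeasurable`, `HardSphereFlowJointMeasurable` in tree; continuity of `φ_N`); no spatial
(kernel-gradient) approximation is made: `MF` is small by `rc2` wherever the ancestors sit. -/
theorem stub_meanFieldDamping :
    ∀ (a₀ θ₀ : T3 → ℝ) (u₀ : T3 → V3), NiceProfiles a₀ θ₀ u₀ →
      ∀ σ : ℝ, 0 < σ → σ < 2⁻¹ → TransferOrthonormal σ → ∀ Φ : Flows σ,
        RCAlongAt σ a₀ θ₀ u₀ Φ → DiffuseAt σ a₀ θ₀ u₀ Φ → TailsAt σ a₀ θ₀ u₀ Φ →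
          MFSmallAt σ a₀ θ₀ u₀ Φ := by
  sorry

/-- STUB 5 (LAGGED SIGNED RESPONSE — the chaos residue; LOAD-BEARING, hardest, size XL). For all nice
profiles there is `σ₀ > 0` such that for `0 < σ < σ₀`, block orthonormality, and every flow family (H1,
H2 offered): for every admissible kernel family and `t > 0` some `c < 1` bounds the response,
`∫₀ᵗ∫ₓ Σ_b Blk_b(s)·(SEL_b + INT_b)(s) ≤ c ∫₀ᵗ∫ₓ (|D|²+|q|²)(s − Δℓ_N) + o(1)` in probability.
WHAT IT SAYS. `SEL + INT` is everything in the one-window transported block moment that a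
velocity-BLIND transfer acting on a HOMOGENEOUS past would not produce: `SEL` = covariance across
ancestors `k` between the shape of the pulled-back row weight `M_ikᵀ C M_ik` and the ancestor tensor
`a_k^{⊗r}` (adapted selection: rows over/under-weight fast, anisotropic ancestors — the Disproof's I2
`adapted_unit_rows_need_not_centre` and S4 `one_reflection_covariance` live here), `INT` = the pair
(rank 2) / triple (rank 3) form in distinct ancestors with kernel `G_{kl} = Σ_i w_i M_ikᵀ C M_il/(N+1)`.
NAKED EQUIVALENT (stated so nobody is fooled): given stubs 3–4 (`MF → 0` in `L²ₜ,ₓ`),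
`⟨Blk, SEL + INT⟩ = |Blk|² − ⟨Blk, MF⟩`, so this stub is equivalent along the line to the LAGGED WINDOW
CONTRACTION `∫_{Δℓ}^t F(s) ds ≤ c ∫_{Δℓ}^t F(s − Δℓ_N) ds + o_P(1)`, `F(s) = ∫ₓ(|D|²+|q|²)(s)`: over one
kinetic window of `n_N → ∞` collision times the block flux defect is multiplied by at most `c < 1`, in
integrated probability (in the chaotic regime the gain is `≈ e^{−(8/5)ν n_N} → 0`, so every fixed
`c ∈ (0, 1)` has margin). It is NOT the circular "INT → 0" of the original card (triage r1-1: on long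
windows `INT = D − tl DIAG → 0 ⟺ D → 0`), because the right-hand side is the defect at the window
START: in the route's kill scenario k4 (anisotropy persistent while rows are diffuse) `MF → 0`,
`SEL + INT → Blk(s) ≈ Blk(s − Δℓ)` and the stub FAILS with `c → 1`, as a load-bearing stub must; and it
is not implied by C in form (C has no window structure), though like every chaos stub of every line on
this crux it holds trivially once C holds (Drefute-r1 §5/§6 "false only if C is false").
WHY PLAUSIBLE (a restoring response is predicted at every finite collision depth, and a window gain
`→ 0`; only `c < 1` is required). (i) Equilibrium-exact: under the invariant Gibbs
law `E[INT_b] = 0` (exchangeability + rotation invariance, for the TRUE adapted `M` — triage r1-2) and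
`E[SEL_b] = 0` (row identity `Σ_k M_ik M_ikᵀ = 𝟙` — triage r1-3); (ii) independent-input part: for
ancestor velocities independent of `M` given the geometry, `INT` is a centred pair form whose kernel has
Hilbert–Schmidt mass `Σ_{k,l}‖G_{kl}‖_F² = Σ_i w_i²‖C‖²/(N+1)² ≲ N^{3γ−1} → 0` (the card's exact identity
`Σ_{i,i'}‖Σ_k M_{i'k} M_ikᵀ‖_F² = 3|B|` is its unweighted form) — Hanson–Wright small — and `SEL` is a
`‖M_ik‖_F⁴`-weighted, i.e. `ipr`-weighted, fluctuation; (iii) the ADAPTED part is a RESTORING response: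
kinetic bookkeeping over a window of `m` own-collisions (triage r1-1 pencil, first Sonine) gives
`D(s) ≈ e^{−(4/5)νm} D(s−Δ)`, blind transport `tl MF ≈ e^{−(2/5)νm} D(s−Δ)`, the missing `(2/5)ν` being
adapted SELECTION (`≈ (1/5)ν`: flux-selected particles carry `3/2 ×` the normal–tangential anisotropy
and each reflection deletes it) + CROSS INTERFERENCE (`≈ (1/5)ν`: Gaussian conditioning at contact,
`E[S_c^{(i)}] = −(θ/5)A` per particle-collision, toy j008832 `−0.4θ` per event) — so
`⟨D(s), (SEL+INT)(s)⟩ ≈ e^{−0.8m}(e^{−0.8m} − e^{−0.4m})|D(s−Δ)|² ≤ 0`: `INT` is ANTI-ALIGNED with `D`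
(pre-registered in toys j010481/j010619/j010642 (r1-1: `cos(INT, D) < 0`, `|tl INT|/|D| ≈ 0.2–0.5` at
`m = 1–2`, `> 1` by `m ≈ 4`) and j010567 (r1-2, stochastic rung)); on admissible windows `m ≍ n_N → ∞`
and every coefficient tends to `0` in the chaotic regime — the required `c < 1` leaves the whole
interval `(0, 1)` as margin for renormalised normal statistics, time variation of `D` inside the window
and the positive sub-leading parts; (iv) cubic channel: the same with the `ℓ = 3` rate (sector constant
`c₃ = 0.57 ± 0.12 < 1` measured on the linear process, j008306) and `SEL₃` slaved to `ipr`.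
WHY IT MIGHT FAIL — this stub carries the line's whole chaos content, stated openly: it is the adapted
pair/selection statistics of ANCESTORS over one kinetic window along the NON-equilibrium local-Gibbs
flow at fixed `σ`, for all `t > 0` — Stosszahlansatz-class (`BoltzmannHypothesisBarrierNarrow` scope (b):
absence of proof, not a counter-theorem), with three named enemies: (1) SUB-BLOCK COHERENCE (triage
r1-2 (F2), r1-3, IdeatorOneNotes B1): a shear/sound mode in the band `N^{-1/3} ≪ ℓ ≪ N^{-γ}` is
hydrodynamic, Galilean-invisible to collisions, gives block-central `D₁₁ ≈ A²/3` and `F(s) ≈ F(s−Δℓ)`,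
i.e. `c ≈ 1`: the stub FAILS unless such modes are absent/short-lived along the flow — meso-quiescence,
owned on this summit by `GermanoSplitLES.MesoQuiescence` (stmt-9198, typed PRE-SHOCK, `t < T`); post-shock
(Kelvin–Helmholtz slip layers down to the mean free path) nobody has a handle: this is the crux's own
`∀ t > 0` exposure (triage crux-level note 1), localised HERE; (2) RINGS at fixed `σ` (recollisions inside
the window, an `O(σ³)` stratum per contact) renormalise the response coefficients (`∃ σ₀`); (3) the k4
scenario itself (persistent anisotropy with diffuse rows) is `c → 1` by the naked form. HOW TO ATTACK IT:
(A) expand `SEL + INT` over the window's collision forest — each collision contributes a coherently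
transported selection/cross increment whose chaos value GIVEN the realised normal is the sibling line's
`chaosCross` (flux-weighted pair of the block law): the sibling's `stub_contactCrossNull` +
`stub_sourceContraction`, read on backward rows, prove this stub (it is their window-level aggregate,
with NO comparison law named — hence not exposed to the deterministic `O(A²)` failure of CCN-as-typed on
sub-block-coherent data, triage r1-3, only to enemy (1) itself); (B) directly, as a TWO-TIME
correlation inequality between the block moment at `s` and a quadratic/cubic form of the velocities at
`s − Δℓ` seen through `M` (decorrelation across the window: the natural currency of a restoring force).
Sources: OllaVaradhanYau1993 §3 (what the closure consumes), Spohn1991 §2.4, CercignaniGabetta2007 ch. 2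
pp. 29/37 (no Wild sum for hard spheres — why no CLT is run), GarzoSantos2003 (USF anisotropy `∝ Kn`,
Disproof §6), Lutsko1996 (doi:10.1103/physrevlett.77.2225; pre-collisional statistics under strong
shear), RudelsonVershynin2013 (arXiv:1306.2872, Hanson–Wright), kit j008832/j010481/j010567. -/
theorem stub_laggedResponse :
    ∀ (a₀ θ₀ : T3 → ℝ) (u₀ : T3 → V3), NiceProfiles a₀ θ₀ u₀ →
      ∃ σ₀ : ℝ, 0 < σ₀ ∧ ∀ σ : ℝ, 0 < σ → σ < σ₀ → TransferOrthonormal σ →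
        ∀ Φ : Flows σ, DiffuseAt σ a₀ θ₀ u₀ Φ → TailsAt σ a₀ θ₀ u₀ Φ →
          LaggedResponseAt σ a₀ θ₀ u₀ Φ := by
  sorry

/-- STUB 6 (REDUCTION, measure theory + the window recursion, size M). For `0 < σ < 1/2` (local Gibbs
laws are probability measures, `isProbabilityMeasure_localGibbsLaw`; `localGibbsLaw ≪ liouville`,
`localGibbsLaw_absolutelyContinuous`, so the dictionary holds LG-a.s. for all `s` at once): the row
split, the flow dictionary, H2, mean-field damping and the lagged response imply the crux's conclusion at
`(σ, profiles, Φ)`. Proof: fix an admissible `(γ, C, φ)`, `t`, `δ`. On the a.s. set, for every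
`s ∈ [0, t]` and `x`: the crux's `D N s z x j k = blkFlow 2 … (C2 j k)` and `(q N s z x) a = blkFlow 3 …
(C3 a)` (empirical integrals are `(N+1)⁻¹`-weighted finite sums — the sibling line's dictionary, audited
in Drefute-r1 §7); the flow dictionary turns `blkFlow` into the block moment `blkF` of the fold restarted
at `winStart` with `m = steps (winLen N s)` steps (`sub_add_cancel`), and the row split paired with the
weights gives `blkF = diagF + intF = mfF + selF + intF` test by test (`blkF` = the sibling's fold-side
block moment `(N+1)⁻¹Σ_i w_i ⟨C, (velAfter m i − u)^{⊗r}⟩`; the second equality is the definition of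
`selF`). Hence pointwise (Young)
`|D|²+|q|² = Σ_b Blk_b (MF_b + SEL_b + INT_b) ≤ η Σ_b Blk_b² + (4η)⁻¹ Σ_b MF_b² + RESP`.
Integrate over `[0, t] × 𝕋³`; outside the bad events of `MFSmallAt` (level `∝ δη(1−η−c⁺)`) and
`LaggedResponseAt` (with its `c < 1`; `c⁺ = max c 0`):
`(1 − η) ∫∫(|D|²+|q|²) ≤ (4η)⁻¹·small + c ∫∫ lagDefect + δ'`, and
`∫₀ᵗ∫ₓ lagDefect = ∫_{Δℓ}^{t} F(s − Δℓ_N) ds = ∫₀^{t−Δℓ} F ≤ ∫₀ᵗ F` (`F ≥ 0`; `lagDefect = 0` in the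
layer by definition, so NO initial-layer term appears here — the layer is inside `MFSmallAt`), whence
`(1 − η − c⁺) ∫₀ᵗ F ≤ (4η)⁻¹·small + δ'`; choose `η = (1 − c⁺)/2`. Union bound over the two bad events
and a null set (monotonicity and subadditivity of the outer measure — no measurability of the events is
needed). The one real obligation (as for the sibling's stub 7): `x`- and `s`-integrability of `MfSq`,
`Resp`, `lagDefect`, `DefectSq` on good orbits (bounded, piecewise constant fold data in `s`, continuous
in `x`; `HardSphereFlowMeasurable`/`HardSphereFlowJointMeasurable` in tree), else Bochner junk-zero could
break the integrated inequality. -/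
theorem stub_reduction :
    ∀ σ : ℝ, 0 < σ → σ < 2⁻¹ → RowSplitIdentity σ → FlowDictionary σ →
      ∀ (a₀ θ₀ : T3 → ℝ) (u₀ : T3 → V3), NiceProfiles a₀ θ₀ u₀ → ∀ Φ : Flows σ,
        TailsAt σ a₀ θ₀ u₀ Φ → MFSmallAt σ a₀ θ₀ u₀ Φ → LaggedResponseAt σ a₀ θ₀ u₀ Φ →
          CruxTail σ a₀ θ₀ u₀ Φ := by
  sorry

end Holds

/-! ## Stub statements by name (D-0027 §3.3: the hypotheses of `_of` are these `Prop`s) -/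

/-- Statement of registered stub 1 (`Holds.stub_rowSplit`), by name. -/
def stub_rowSplit : Prop := type_of% Holds.stub_rowSplit
/-- Statement of registered stub 2 (`Holds.stub_flowDictionary`), by name. -/
def stub_flowDictionary : Prop := type_of% Holds.stub_flowDictionary
/-- Statement of registered stub 3 (`Holds.stub_rowContraction`), by name. -/
def stub_rowContraction : Prop := type_of% Holds.stub_rowContraction
/-- Statement of registered stub 4 (`Holds.stub_meanFieldDamping`), by name. -/
def stub_meanFieldDamping : Prop := type_of% Holds.stub_meanFieldDamping
/-- Statement of registered stub 5 (`Holds.stub_laggedResponse`), by name. -/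
def stub_laggedResponse : Prop := type_of% Holds.stub_laggedResponse
/-- Statement of registered stub 6 (`Holds.stub_reduction`), by name. -/
def stub_reduction : Prop := type_of% Holds.stub_reduction

/-! ## Composition (sorry-free): the six stubs ⟹ the crux BY NAME -/

/-- **The skeleton theorem.** `σ₀ := min (min σ_RC σ_LR) 2⁻¹`. For `σ < σ₀` and a flow family `Φ`,
after introducing the crux's `let M; let ipr` and its two hypotheses, H1 is this file's `DiffuseAt` and
H2 is `TailsAt` definitionally (shared `iprF`); stub 6 is fed the row split (stub 1a), the dictionary
(stub 2), H2, mean-field damping (stub 4, itself fed block orthonormality (stub 1b), row contraction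
(stub 3 ⇐ stub 1b, H1), H1 and H2) and the lagged response (stub 5 ⇐ stub 1b, H1, H2), and returns
`CruxTail σ a₀ θ₀ u₀ Φ` — the crux's conclusion verbatim. -/
theorem AdaptedWeightCLT_of
    (h1 : stub_rowSplit) (h2 : stub_flowDictionary) (h3 : stub_rowContraction)
    (h4 : stub_meanFieldDamping) (h5 : stub_laggedResponse) (h6 : stub_reduction) :
    Summit.AtomisticToContinuum.HydrodynamicLimit.Theses.CollisionIsometryCLT.AdaptedWeightCLT := by
  intro a₀ θ₀ u₀ ha hθ hu ha0 hθ0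
  have hP : NiceProfiles a₀ θ₀ u₀ := ⟨ha, hθ, hu, ha0, hθ0⟩
  have H1 := (h1 : type_of% Holds.stub_rowSplit)
  have H2 := (h2 : type_of% Holds.stub_flowDictionary)
  obtain ⟨σ₃, hσ₃, H3⟩ := (h3 : type_of% Holds.stub_rowContraction) a₀ θ₀ u₀ hP
  have H4 := (h4 : type_of% Holds.stub_meanFieldDamping)
  obtain ⟨σ₅, hσ₅, H5⟩ := (h5 : type_of% Holds.stub_laggedResponse) a₀ θ₀ u₀ hP
  have H6 := (h6 : type_of% Holds.stub_reduction)
  refine ⟨min (min σ₃ σ₅) 2⁻¹, ?_, ?_⟩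
  · exact lt_min (lt_min hσ₃ hσ₅) (by norm_num)
  intro σ hσ hlt
  have h3lt : σ < σ₃ := lt_of_lt_of_le hlt ((min_le_left _ _).trans (min_le_left _ _))
  have h5lt : σ < σ₅ := lt_of_lt_of_le hlt ((min_le_left _ _).trans (min_le_right _ _))
  have hhalf : σ < 2⁻¹ := lt_of_lt_of_le hlt (min_le_right _ _)
  intro M ipr Φ hH1 hH2
  have hD : DiffuseAt σ a₀ θ₀ u₀ Φ := hH1
  have hT : TailsAt σ a₀ θ₀ u₀ Φ := hH2
  have hRS : RowSplitIdentity σ := (H1 σ).1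
  have hTO : TransferOrthonormal σ := (H1 σ).2
  have hRC : RCAlongAt σ a₀ θ₀ u₀ Φ := H3 σ hσ h3lt hTO Φ hD
  have hMF : MFSmallAt σ a₀ θ₀ u₀ Φ := H4 a₀ θ₀ u₀ hP σ hσ hhalf hTO Φ hRC hD hT
  have hLR : LaggedResponseAt σ a₀ θ₀ u₀ Φ := H5 σ hσ h5lt hTO Φ hD hT
  exact H6 σ hσ hhalf hRS (H2 σ hσ hhalf) a₀ θ₀ u₀ hP Φ hT hMF hLR

/-- D-0027 §3.3 shape: the crux from the registered stubs — an `example`, so that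
`AdaptedWeightCLT_of` stays the unique theorem concluding the crux; it becomes the proof of the item
once the six `sorry`s are discharged. -/
example : Summit.AtomisticToContinuum.HydrodynamicLimit.Theses.CollisionIsometryCLT.AdaptedWeightCLT :=
  AdaptedWeightCLT_of Holds.stub_rowSplit Holds.stub_flowDictionary Holds.stub_rowContraction
    Holds.stub_meanFieldDamping Holds.stub_laggedResponse Holds.stub_reduction

end

end Summit.AtomisticToContinuum.HydrodynamicLimit.Cruxes.AdaptedWeightCLT.MomentTransportIsotropyParity
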